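import Literature.Geometry.Riemannian.ShrinkerEntropyProofs
import Mathlib.Analysis.SpecialFunctions.Log.NegMulLog

/-!
# Mixture toolkit for stub `stub_compactSupportLSI` (U1) of line `collapsed-ends-usc`
# (crux `EntropyRung.NoncompactShrinkerGap`, stmt-SmoothPoincare4-10868)

Fact-free lemmas consumed by `EntropyRungNoncompactShrinkerGapStubCompactSupportLSI.lean`
(Carrillo–Ni's logarithmic Sobolev inequality for compactly supported test functions on a
complete gradient shrinker, Haslhofer–Müller 2011 (2.15)–(2.16), proved there by MIXTURES
`u_δ = (1−δ) w²/Z + δ e^{-f}/∫e^{-f}` of the test density with the Gaussian density of the soliton):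
* `innerDual_self_nonneg`, `innerDual_mixture_le`, `gradSq_mixture_mul_le` — `g⁻¹ ≥ 0` for a
  Riemannian `g` and the perspective (joint convexity) inequality for the Fisher-information term
  of a mixture, `|∇(αw² + b)|²/(αw² + b) ≤ 4α|∇w|² + |∇b|²/b` with `b = β e^{-f}`, valid across
  the zero set of `w`;
* `negMulLog_add_le` — subadditivity `−(a+b) log (a+b) ≤ −a log a − b log b` (mixing entropy);
* `isCompact_sublevel_of_growth`, `toReal_edist_sq_le` — properness of a potential with the
  quadratic lower growth `¼(d − K)₊² ≤ f` of Haslhofer–Müller's Lemma 2.1 when closed balls are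
  compact, and the second-moment control `d(p, ·)² ≤ 8f + 2K²`;
* `mixture_entropy_le`, `mixture_integrand_le` — the pointwise bound of the `𝒲`-integrand of
  `ψ_δ = log A − log u_δ` by `(1−δ)/Z ·`(integrand of `w`) `+ δ/∫e^{-f} ·`(integrand of `f + c`)
  plus the mixing-entropy terms;
* `le_of_forall_mixture_bound` — `δ → 0`: `c ≤ (1−δ)F + δc + h(δ)` for all `δ ∈ (0,1)` gives
  `c ≤ F` (`h(δ) = −(1−δ) log (1−δ) − δ log δ → 0`);
* `integrable_of_le_of_le` — integrability by sandwich.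
Everything is proved; no definition, no named fact.
-/

noncomputable section

-- `Summit.SmoothPoincare4.SmoothPoincare4.…` (summit = problem) trips `dupNamespace` on every decl.
set_option linter.dupNamespace false

open scoped Manifold ContDiff ENNReal NNReal Topology
open MeasureTheory Set Filter
open Literature.Geometry.Lorentzian Literature.Geometry.Riemannian

namespace Summit.SmoothPoincare4.SmoothPoincare4.Theorems.NoncompactShrinkerGapCompactSupportLSI


/-! ## Pointwise algebra of the inverse metric -/

section Pointwise

variable {E : Type*} [NormedAddCommGroup E] [NormedSpace ℝ E] {H : Type*} [TopologicalSpace H]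
  {I : ModelWithCorners ℝ E H} {M : Type*} [TopologicalSpace M] [ChartedSpace H M]
  [IsManifold I ∞ M] {n : ℕ∞ω} [FiniteDimensional ℝ E]
  (g : PseudoRiemannianMetric I n E (TangentSpace I : M → Type _))

/-- For a Riemannian metric the inverse metric is positive semidefinite: `g⁻¹(γ, γ) ≥ 0`.
[folklore] -/
theorem innerDual_self_nonneg (hg : g.IsRiemannian) (x : M)
    (γ : Module.Dual ℝ (TangentSpace I x)) : 0 ≤ g.innerDual x γ γ := by
  -- adapted from work/stubs/U_helpers.lean (wave 1)
  rw [PseudoRiemannianMetric.innerDual_eq_val_sharp_sharp]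
  by_cases h : g.sharp x γ = 0
  · rw [h]; simp
  · exact (hg x _ h).le

/-- **Perspective inequality for a mixture `α s² + b`** at the level of covectors: for `α ≥ 0`,
`b > 0` and covectors `σ = ds`, `τ` with `d b = −b τ`,
`g⁻¹(2αs σ − b τ, 2αs σ − b τ) ≤ (4α g⁻¹(σ,σ) + b g⁻¹(τ,τ)) (α s² + b)` — i.e.
`|∇(αs² + b)|²/(αs² + b) ≤ 4α|∇s|² + |∇b|²/b`, valid also where `s = 0`. Proof:
the difference is `αb · g⁻¹(2σ + sτ, 2σ + sτ) ≥ 0`. [folklore] -/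
theorem innerDual_mixture_le (hg : g.IsRiemannian) (x : M) (σ τ : Module.Dual ℝ (TangentSpace I x))
    {α s b : ℝ} (hα : 0 ≤ α) (hb : 0 < b) :
    g.innerDual x ((2 * α * s) • σ + (-b) • τ) ((2 * α * s) • σ + (-b) • τ) ≤
      (4 * α * g.innerDual x σ σ + b * g.innerDual x τ τ) * (α * s ^ 2 + b) := by
  have hpsd := innerDual_self_nonneg g hg x ((2 : ℝ) • σ + s • τ)
  have hcomm := PseudoRiemannianMetric.innerDual_comm g x σ τ
  simp only [PseudoRiemannianMetric.innerDual, map_add, map_smul, LinearMap.add_apply,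
    LinearMap.smul_apply, smul_eq_mul] at hpsd hcomm ⊢
  nlinarith [mul_nonneg (mul_nonneg hα hb.le) hpsd, hcomm]

/-- **Perspective inequality for the gradient term of a mixture**: for `u = α w² + β e^{-f}` with
`α ≥ 0`, `β > 0` and `ψ = A − log u`, `|∇ψ|² u = |∇u|²/u ≤ 4α |∇w|² + β e^{-f} |∇f|²` at every
point where `w`, `f` are differentiable. [folklore] -/
theorem gradSq_mixture_mul_le (hg : g.IsRiemannian) {w f : M → ℝ} {x : M}
    (hw : MDifferentiableAt I 𝓘(ℝ, ℝ) w x) (hf : MDifferentiableAt I 𝓘(ℝ, ℝ) f x)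
    {α β : ℝ} (A : ℝ) (hα : 0 ≤ α) (hβ : 0 < β) :
    g.gradSq (fun y ↦ A - Real.log (α * w y ^ 2 + β * Real.exp (-f y))) x *
        (α * w x ^ 2 + β * Real.exp (-f x)) ≤
      4 * α * g.gradSq w x + β * Real.exp (-f x) * g.gradSq f x := by
  set u : M → ℝ := fun y ↦ α * w y ^ 2 + β * Real.exp (-f y) with hu
  have hux : u x = α * w x ^ 2 + β * Real.exp (-f x) := rfl
  have hbpos : 0 < β * Real.exp (-f x) := mul_pos hβ (Real.exp_pos _)
  have hupos : 0 < u x := by rw [hux]; positivity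
  -- the two summands as compositions with real functions
  have h1' : HasDerivAt (fun t : ℝ ↦ t ^ 2) (2 * w x) (w x) := by
    simpa using hasDerivAt_pow 2 (w x)
  have h1 : HasDerivAt (fun t : ℝ ↦ α * t ^ 2) (2 * α * w x) (w x) :=
    (h1'.const_mul α).congr_deriv (by ring)
  have h2 : HasDerivAt (fun t : ℝ ↦ β * Real.exp (-t)) (-(β * Real.exp (-f x))) (f x) :=
    (((hasDerivAt_neg (f x)).exp).const_mul β).congr_deriv (by ring)
  have hu1d : MDifferentiableAt I 𝓘(ℝ, ℝ) ((fun t : ℝ ↦ α * t ^ 2) ∘ w) x :=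
    (h1.hasFDerivAt.hasMFDerivAt.comp x hw.hasMFDerivAt).mdifferentiableAt
  have hu2d : MDifferentiableAt I 𝓘(ℝ, ℝ) ((fun t : ℝ ↦ β * Real.exp (-t)) ∘ f) x :=
    (h2.hasFDerivAt.hasMFDerivAt.comp x hf.hasMFDerivAt).mdifferentiableAt
  have hueq : u = ((fun t : ℝ ↦ α * t ^ 2) ∘ w) + ((fun t : ℝ ↦ β * Real.exp (-t)) ∘ f) := rfl
  have hud : MDifferentiableAt I 𝓘(ℝ, ℝ) u x := by rw [hueq]; exact hu1d.add hu2d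
  -- the differential of `u`
  have hdu : ∀ v, mvfderiv I u x v =
      2 * α * w x * mvfderiv I w x v + -(β * Real.exp (-f x)) * mvfderiv I f x v := by
    intro v
    rw [hueq, mvfderiv_add hu1d hu2d, add_apply,
      mvfderiv_real_comp_apply h1 hw, mvfderiv_real_comp_apply h2 hf]
  have hduL : (mvfderiv I u x : TangentSpace I x →ₗ[ℝ] ℝ) =
      (2 * α * w x) • (mvfderiv I w x : TangentSpace I x →ₗ[ℝ] ℝ) +
        (-(β * Real.exp (-f x))) • (mvfderiv I f x : TangentSpace I x →ₗ[ℝ] ℝ) := by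
    ext v
    simp [hdu v]
  -- chain rule for `log` and the covector inequality
  have hchain := g.gradSq_const_sub_log_comp A hupos hud
  have key := innerDual_mixture_le g hg x (mvfderiv I w x : TangentSpace I x →ₗ[ℝ] ℝ)
    (mvfderiv I f x : TangentSpace I x →ₗ[ℝ] ℝ) (s := w x) hα hbpos
  rw [← hduL] at key
  change g.gradSq u x ≤ (4 * α * g.gradSq w x + β * Real.exp (-f x) * g.gradSq f x) * u x at key
  show g.gradSq (fun y ↦ A - Real.log (u y)) x * u x ≤ _
  rw [hchain]
  have : (u x)⁻¹ ^ 2 * g.gradSq u x * u x = g.gradSq u x / u x := by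
    field_simp
  rw [this, div_le_iff₀ hupos]
  exact key

end Pointwise

/-- **Subadditivity of `−t log t` on `[0, ∞)`**: `−(a+b) log (a+b) ≤ −a log a − b log b`
(`log` is monotone). The mixing-entropy bound for densities. [folklore] -/
theorem negMulLog_add_le {a b : ℝ} (ha : 0 ≤ a) (hb : 0 ≤ b) :
    Real.negMulLog (a + b) ≤ Real.negMulLog a + Real.negMulLog b := by
  rcases ha.eq_or_lt with rfl | ha'
  · simp
  rcases hb.eq_or_lt with rfl | hb'
  · simp
  have h1 : Real.log a ≤ Real.log (a + b) := Real.log_le_log ha' (by linarith)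
  have h2 : Real.log b ≤ Real.log (a + b) := Real.log_le_log hb' (by linarith)
  simp only [Real.negMulLog]
  nlinarith [mul_le_mul_of_nonneg_left h1 ha, mul_le_mul_of_nonneg_left h2 hb]

/-! ## Properness and the second moment from the growth of the potential -/

section Growth

variable {E : Type*} [NormedAddCommGroup E] [NormedSpace ℝ E] [FiniteDimensional ℝ E]
  {H : Type*} [TopologicalSpace H] {I : ModelWithCorners ℝ E H} {M : Type*} [TopologicalSpace M]
  [ChartedSpace H M] [IsManifold I ∞ M]
  {g : PseudoRiemannianMetric I ∞ E (TangentSpace I : M → Type _)}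

/-- **A potential with quadratic lower growth is proper** when closed `g`-balls are compact:
`¼(r − K)₊² ≤ f(x)` whenever `r ≤ d(p, x)` forces `{f ≤ R} ⊆ {d(p, ·) ≤ 2√(R₊ + 1) + K₊}`.
[folklore] -/
theorem isCompact_sublevel_of_growth (hg : g.IsRiemannian) {f : M → ℝ} (hf : Continuous f)
    (hc : ∀ (x : M) (r : NNReal), IsCompact {y : M | g.edist hg x y ≤ r}) {p : M} {K : ℝ}
    (hlow : ∀ (x : M) (r : NNReal), (r : ℝ≥0∞) ≤ g.edist hg p x →
      (1 / 4 : ℝ) * (max ((r : ℝ) - K) 0) ^ 2 ≤ f x)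
    (R : ℝ) : IsCompact {x | f x ≤ R} := by
  set R' : ℝ := max R 0 with hR'
  have hR'0 : 0 ≤ R' := le_max_right _ _
  have hRR' : R ≤ R' := le_max_left _ _
  set r₀ : NNReal := ⟨2 * Real.sqrt (R' + 1) + max K 0, by positivity⟩ with hr₀
  have hr₀v : (r₀ : ℝ) = 2 * Real.sqrt (R' + 1) + max K 0 := rfl
  refine (hc p r₀).of_isClosed_subset (isClosed_le hf continuous_const) fun x hx ↦ ?_
  by_contra hxr
  have hle : (r₀ : ℝ≥0∞) ≤ g.edist hg p x := (lt_of_not_ge hxr).le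
  have hfx := hlow x r₀ hle
  have hr₀K : 2 * Real.sqrt (R' + 1) ≤ max ((r₀ : ℝ) - K) 0 := by
    refine le_max_of_le_left ?_
    rw [hr₀v]
    linarith [le_max_left K 0]
  have hsq : (2 * Real.sqrt (R' + 1)) ^ 2 ≤ (max ((r₀ : ℝ) - K) 0) ^ 2 :=
    pow_le_pow_left₀ (by positivity) hr₀K 2
  have h4 : (2 * Real.sqrt (R' + 1)) ^ 2 = 4 * (R' + 1) := by
    rw [mul_pow, Real.sq_sqrt (by positivity)]; ring
  have : f x ≤ R := hx
  linarith

/-- **Second-moment control from the lower growth bound**: if `¼(r − K)₊² ≤ f(x)` for every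
`r ≤ d(p, x)` and `d(p, x) < ∞`, then `d(p, x)² ≤ 8 f(x) + 2K²`. [folklore] -/
theorem toReal_edist_sq_le (hg : g.IsRiemannian) {f : M → ℝ} {p x : M} {K : ℝ}
    (hlow : ∀ r : NNReal, (r : ℝ≥0∞) ≤ g.edist hg p x →
      (1 / 4 : ℝ) * (max ((r : ℝ) - K) 0) ^ 2 ≤ f x)
    (hfin : g.edist hg p x < ⊤) : (g.edist hg p x).toReal ^ 2 ≤ 8 * f x + 2 * K ^ 2 := by
  set r : NNReal := (g.edist hg p x).toNNReal with hr
  have hrr : (r : ℝ≥0∞) = g.edist hg p x := ENNReal.coe_toNNReal hfin.ne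
  have h := hlow r hrr.le
  have htoReal : (g.edist hg p x).toReal = (r : ℝ) := rfl
  rw [htoReal]
  set m : ℝ := max ((r : ℝ) - K) 0 with hm
  have hm0 : 0 ≤ m := le_max_right _ _
  have hrm : (r : ℝ) ≤ m + K := by linarith [le_max_left ((r : ℝ) - K) 0]
  have hr0 : 0 ≤ (r : ℝ) := r.2
  have h1 : (r : ℝ) ^ 2 ≤ (m + K) ^ 2 := pow_le_pow_left₀ hr0 hrm 2
  nlinarith [sq_nonneg (m - K)]

end Growth

/-! ## Real-variable lemmas for the mixture -/

/-- **The entropy term of the mixture, pointwise**: for `u = (1−δ)/Z · s² + δ/I₀ · e^{-t}` and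
`ψ = log A − log u`, `ψ u ≤ (1−δ)/Z · [(log Z − log (1−δ) + log A) s² − s² log s²]
 + δ/I₀ · e^{-t} (t + c − log δ)` where `log I₀ = c − log A` (subadditivity of `−x log x` and
`log` of products). [folklore] -/
theorem mixture_entropy_le {A Z I₀ δ c : ℝ} (hZ : 0 < Z) (hI₀ : 0 < I₀) (hδ0 : 0 < δ)
    (hδ1 : δ < 1) (hcA : Real.log I₀ = c - Real.log A) (s t : ℝ) :
    (Real.log A - Real.log ((1 - δ) / Z * s ^ 2 + δ / I₀ * Real.exp (-t))) *
        ((1 - δ) / Z * s ^ 2 + δ / I₀ * Real.exp (-t)) ≤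
      (1 - δ) / Z * ((Real.log Z - Real.log (1 - δ) + Real.log A) * s ^ 2 - s ^ 2 * Real.log (s ^ 2)) +
        δ / I₀ * (Real.exp (-t) * (t + c - Real.log δ)) := by
  have h1δ : 0 < 1 - δ := by linarith
  set α : ℝ := (1 - δ) / Z with hα
  set β : ℝ := δ / I₀ with hβ
  have hα0 : 0 < α := div_pos h1δ hZ
  have hβ0 : 0 < β := div_pos hδ0 hI₀
  set u : ℝ := α * s ^ 2 + β * Real.exp (-t) with hu
  have hsplit : (Real.log A - Real.log u) * u = Real.log A * u + Real.negMulLog u := by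
    rw [Real.negMulLog]; ring
  have hsub := negMulLog_add_le (a := α * s ^ 2) (b := β * Real.exp (-t)) (by positivity)
    (by positivity)
  have e1 : Real.negMulLog (α * s ^ 2) =
      α * ((Real.log Z - Real.log (1 - δ)) * s ^ 2 - s ^ 2 * Real.log (s ^ 2)) := by
    rw [Real.negMulLog_mul, Real.negMulLog, Real.negMulLog, hα, Real.log_div h1δ.ne' hZ.ne']
    ring
  have e2 : Real.negMulLog (β * Real.exp (-t)) =
      β * (Real.exp (-t) * (t - Real.log δ + Real.log I₀)) := by
    rw [Real.negMulLog_mul, Real.negMulLog, Real.negMulLog, Real.log_exp, hβ,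
      Real.log_div hδ0.ne' hI₀.ne']
    ring
  rw [← hu, e1, e2, hcA] at hsub
  have hAu : Real.log A * u = α * (Real.log A * s ^ 2) + β * (Real.exp (-t) * Real.log A) := by
    rw [hu]; ring
  rw [hsplit, hAu]
  linarith

/-- **The `𝒲`-integrand of the mixture, pointwise** (linear bookkeeping): with `u = α s² + β e`,
the gradient bound `G_ψ u ≤ 4α G_w + β e G_f` and the entropy bound of `mixture_entropy_le`,
`(S + G_ψ + ψ − n) u ≤ α [S s² + 4 G_w − s² log s² + (log Z + log A − n − log (1−δ)) s²]
 + β [(S + G_f + t + c − n) e − (log δ) e]`. [folklore] -/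
theorem mixture_integrand_le {S Gψ ψ u s e Gw Gf t α β A Z δ c m : ℝ}
    (hu : u = α * s ^ 2 + β * e) (h1 : Gψ * u ≤ 4 * α * Gw + β * e * Gf)
    (h2 : ψ * u ≤ α * ((Real.log Z - Real.log (1 - δ) + Real.log A) * s ^ 2 - s ^ 2 * Real.log (s ^ 2)) +
      β * (e * (t + c - Real.log δ))) :
    ((S + Gψ) + ψ - m) * u ≤
      α * ((S * s ^ 2 + 4 * Gw - s ^ 2 * Real.log (s ^ 2)) +
          (Real.log Z + Real.log A - m - Real.log (1 - δ)) * s ^ 2) +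
        β * ((S + Gf + (t + c) - m) * e + (-Real.log δ) * e) := by
  have hSu : S * u = α * (S * s ^ 2) + β * (S * e) := by rw [hu]; ring
  have hnu : m * u = α * (m * s ^ 2) + β * (m * e) := by rw [hu]; ring
  have hW : ((S + Gψ) + ψ - m) * u = S * u + Gψ * u + ψ * u - m * u := by ring
  rw [hW, hSu, hnu]
  linarith

/-- **The limit `δ → 0`**: if `c ≤ (1−δ) F + δ c − (1−δ) log (1−δ) − δ log δ` for all
`0 < δ < 1`, then `c ≤ F` (the mixing entropy `h(δ) → 0`). [folklore] -/
theorem le_of_forall_mixture_bound {c F : ℝ}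
    (h : ∀ δ : ℝ, 0 < δ → δ < 1 →
      c ≤ (1 - δ) * F + δ * c + (Real.negMulLog (1 - δ) + Real.negMulLog δ)) : c ≤ F := by
  have hlim : Tendsto (fun δ : ℝ ↦ (Real.negMulLog (1 - δ) + Real.negMulLog δ) / (1 - δ))
      (𝓝 0) (𝓝 0) := by
    have h1 : ContinuousAt (fun δ : ℝ ↦ (Real.negMulLog (1 - δ) + Real.negMulLog δ) / (1 - δ)) 0 :=
      (((Real.continuous_negMulLog.comp (continuous_const.sub continuous_id)).add
        Real.continuous_negMulLog).continuousAt).div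
        (continuous_const.sub continuous_id).continuousAt (by norm_num)
    simpa [ContinuousAt] using h1
  have hev : ∀ᶠ δ in 𝓝[>] (0 : ℝ),
      c - F ≤ (Real.negMulLog (1 - δ) + Real.negMulLog δ) / (1 - δ) := by
    filter_upwards [Ioo_mem_nhdsGT (zero_lt_one' ℝ)] with δ hδ
    have h1δ : 0 < 1 - δ := by linarith [hδ.2]
    rw [le_div_iff₀ h1δ]
    have := h δ hδ.1 hδ.2
    nlinarith
  have hfinal : c - F ≤ 0 := ge_of_tendsto (hlim.mono_left nhdsWithin_le_nhds) hev
  linarith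

/-- **Integrability by sandwich**: an a.e. strongly measurable `W` squeezed between two
integrable functions is integrable. [folklore] -/
theorem integrable_of_le_of_le {X : Type*} [MeasurableSpace X] {μ : Measure X} {W G₁ G₂ : X → ℝ}
    (hW : AEStronglyMeasurable W μ) (h₁ : Integrable G₁ μ) (h₂ : Integrable G₂ μ)
    (hlo : ∀ x, G₂ x ≤ W x) (hhi : ∀ x, W x ≤ G₁ x) : Integrable W μ := by
  refine (h₁.norm.add h₂.norm).mono hW (ae_of_all _ fun x ↦ ?_)
  simp only [Pi.add_apply, Real.norm_eq_abs]
  have h := abs_le_max_abs_abs (hlo x) (hhi x)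
  have h' : max |G₂ x| |G₁ x| ≤ |G₁ x| + |G₂ x| :=
    max_le (le_add_of_nonneg_left (abs_nonneg _)) (le_add_of_nonneg_right (abs_nonneg _))
  exact h.trans (h'.trans (le_abs_self _))

/-! ## Registered sub-goal (U1a) -/

/-- **Sub-goal `stub_mixtureFisherInformation` (U1a) of stub `stub_compactSupportLSI`** — the
Fisher information of a mixture is dominated: on a Riemannian manifold modelled on `ℝⁿ`, for
`u = α w² + β e^{-f}` (`α ≥ 0`, `β > 0`) and `ψ = A − log u`,
`|∇ψ|² u = |∇u|²/u ≤ 4α |∇w|² + β e^{-f} |∇f|²` at every point where `w`, `f` are differentiable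
(perspective inequality; `gradSq_mixture_mul_le`). This is what makes the `𝒲`-integrand of the
mixture test functions of U1 integrable and convex in the mixing parameter. [folklore] -/
theorem stub_mixtureFisherInformation : ∀ (n : ℕ) (M : Type) [TopologicalSpace M] [ChartedSpace (EuclideanSpace ℝ (Fin n)) M] [IsManifold (𝓡 n) ∞ M] (g : PseudoRiemannianMetric (𝓡 n) ∞ (EuclideanSpace ℝ (Fin n)) (TangentSpace (𝓡 n) : M → Type _)), g.IsRiemannian → ∀ (w f : M → ℝ) (x : M), MDifferentiableAt (𝓡 n) 𝓘(ℝ, ℝ) w x → MDifferentiableAt (𝓡 n) 𝓘(ℝ, ℝ) f x → ∀ (α β A : ℝ), 0 ≤ α → 0 < β → g.gradSq (fun y ↦ A - Real.log (α * w y ^ 2 + β * Real.exp (-f y))) x * (α * w x ^ 2 + β * Real.exp (-f x)) ≤ 4 * α * g.gradSq w x + β * Real.exp (-f x) * g.gradSq f x := by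
  intro n M _ _ _ g hg w f x hw hf α β A hα hβ
  exact gradSq_mixture_mul_le g hg hw hf A hα hβ

end Summit.SmoothPoincare4.SmoothPoincare4.Theorems.NoncompactShrinkerGapCompactSupportLSI

end
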